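import Mathlib
import Summits.ResolutionOfSingularities.ResolutionOfSingularities.Theorems.FrobeniusLadderFRationalResolutionModelLocal
import Summits.ResolutionOfSingularities.ResolutionOfSingularities.Theorems.FrobeniusLadderFRationalResolutionSpecHypersurface
import HarnessLib

/-!
# The punctual engine is punctual: weakly F-regular proper models glue point by point
(crux `FrobeniusLadder.FRationalResolution`, line `Sketch`)

Stub `weaklyFRegularModel_of_local_models` of the skeleton `Sketch` for crux
stmt-ResolutionOfSingularities-15317. Call a scheme *stalkwise weakly F-regular* (for the fixed
exponent base `p`) if every stalk is a domain in which every ideal `I` is tightly closed in the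
crux's inline sense: `c ≠ 0` and `c · y^(p^e) ∈ span {z^(p^e) | z ∈ I}` for all `e` force `y ∈ I`.
Let `U ⊆ X` be an open all of whose points have such stalks, and `S ⊆ X` a finite set of points
with `X = U ∪ S`; suppose every `s ∈ S` has an open neighbourhood `V ∋ s` meeting `S` only in `s`
and carrying a local model `ρ : Y → V` (proper, `Y` stalkwise weakly F-regular, an isomorphism over
`V ∩ U` with dense preimage). Then `X` receives a proper `π : X' → X` from a stalkwise weakly
F-regular scheme which is an isomorphism over `U` with dense preimage of `U`.

This is the case `P Z := "Z is stalkwise weakly F-regular"` of the property-agnostic engine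
`stub_model_of_local_models` (`…ModelLocal.lean`). The two inputs: `P` glues along two-piece open
covers `Z = i(A) ∪ j(B)` because every point of `Z` is `i a` or `j b` and the stalk maps of open
immersions are isomorphisms, along which the clause transports (`allIdeals_clause_of_ringEquiv`,
`…SpecHypersurface.lean`); and `P ↑U` holds because the stalks of the open subscheme `↑U` are the
stalks of `X` at the points of `U` (again via the stalk isomorphisms of the open immersion `U.ι`).
-/

set_option linter.dupNamespace false

noncomputable section

open CategoryTheory CategoryTheory.Limits AlgebraicGeometry TopologicalSpace
  Literature.AlgebraicGeometry.Resolution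

namespace Summit.ResolutionOfSingularities.ResolutionOfSingularities.Theorems.FRationalResolution

/-- Transport of "domain in which every ideal is tightly closed (inline clause)" along an
isomorphism `e : R ≅ S` of commutative rings (in `CommRingCat`): the statement for `S` gives it for
`R` (`MulEquiv.isDomain` and `allIdeals_clause_of_ringEquiv` for the ring isomorphism underlying
`e`). -/
theorem domain_allIdeals_clause_of_iso (p : ℕ) {R S : CommRingCat.{0}} (e : R ≅ S)
    (h : IsDomain S ∧ ∀ (I : Ideal S) (y c : S), c ≠ 0 →
      (∀ n : ℕ, c * y ^ p ^ n ∈ Ideal.span ((fun z : S => z ^ p ^ n) '' (I : Set S))) → y ∈ I) :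
    IsDomain R ∧ ∀ (I : Ideal R) (y c : R), c ≠ 0 →
      (∀ n : ℕ, c * y ^ p ^ n ∈ Ideal.span ((fun z : R => z ^ p ^ n) '' (I : Set R))) → y ∈ I := by
  obtain ⟨hdom, hcl⟩ := h
  exact ⟨MulEquiv.isDomain _ e.commRingCatIsoToRingEquiv.toMulEquiv,
    allIdeals_clause_of_ringEquiv p e.commRingCatIsoToRingEquiv hcl⟩

/-- **THE PUNCTUAL ENGINE IS PUNCTUAL.** Let `U ⊆ X` be an open at whose points the stalks of `X`
are domains with every ideal tightly closed (inline clause for the exponent base `p`), and `S` a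
finite set of points with `X = U ∪ S`, such that every `s ∈ S` has an open neighbourhood `V` with
`V ∩ S = {s}` carrying a proper `ρ : Y → V`, all stalks of `Y` domains with every ideal tightly
closed, which is an isomorphism over `V ∩ U` with dense preimage. Then there is a proper
`π : X' → X`, all stalks of `X'` domains with every ideal tightly closed, which is an isomorphism
over `U` with dense preimage of `U`. This is `stub_model_of_local_models` for the property
"every stalk is a domain with all ideals tightly closed", which glues along two-piece open covers
and passes to the open subscheme `↑U` because stalk maps of open immersions are isomorphisms
(`domain_allIdeals_clause_of_iso`). [folklore] -/
theorem weaklyFRegularModel_of_local_models (p : ℕ) (X : Scheme.{0}) (U : X.Opens)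
    (hU : ∀ x : X, x ∈ U → IsDomain (X.presheaf.stalk x) ∧ ∀ I : Ideal (X.presheaf.stalk x),
      ∀ y c : X.presheaf.stalk x, c ≠ 0 →
      (∀ e : ℕ, c * y ^ p ^ e ∈ Ideal.span ((fun z : X.presheaf.stalk x => z ^ p ^ e) ''
        (I : Set (X.presheaf.stalk x)))) → y ∈ I)
    (S : Finset X) (hcov : ∀ x : X, x ∈ U ∨ x ∈ S)
    (hloc : ∀ s ∈ S, ∃ (V : X.Opens), s ∈ V ∧ (∀ t ∈ S, t ∈ V → t = s) ∧
      ∃ (Y : Scheme.{0}) (ρ : Y ⟶ V), IsProper ρ ∧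
        (∀ y : Y, IsDomain (Y.presheaf.stalk y) ∧ ∀ I : Ideal (Y.presheaf.stalk y),
          ∀ a c : Y.presheaf.stalk y, c ≠ 0 →
          (∀ e : ℕ, c * a ^ p ^ e ∈ Ideal.span ((fun z : Y.presheaf.stalk y => z ^ p ^ e) ''
            (I : Set (Y.presheaf.stalk y)))) → a ∈ I) ∧
        IsIso (ρ ∣_ (V.ι ⁻¹ᵁ U)) ∧ Dense ((ρ ⁻¹ᵁ (V.ι ⁻¹ᵁ U) : Y.Opens) : Set Y)) :
    ∃ (X' : Scheme.{0}) (π : X' ⟶ X), IsProper π ∧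
      (∀ x : X', IsDomain (X'.presheaf.stalk x) ∧ ∀ I : Ideal (X'.presheaf.stalk x),
        ∀ y c : X'.presheaf.stalk x, c ≠ 0 →
        (∀ e : ℕ, c * y ^ p ^ e ∈ Ideal.span ((fun z : X'.presheaf.stalk x => z ^ p ^ e) ''
          (I : Set (X'.presheaf.stalk x)))) → y ∈ I) ∧
      IsIso (π ∣_ U) ∧ Dense ((π ⁻¹ᵁ U : X'.Opens) : Set X') := by
  -- `stub_model_of_local_models` for the property `P Z`: every stalk of `Z` is a domain with
  -- all ideals tightly closed
  refine stub_model_of_local_models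
    (fun Z : Scheme.{0} => ∀ z : Z, IsDomain (Z.presheaf.stalk z) ∧
      ∀ I : Ideal (Z.presheaf.stalk z), ∀ y c : Z.presheaf.stalk z, c ≠ 0 →
        (∀ e : ℕ, c * y ^ p ^ e ∈ Ideal.span ((fun w : Z.presheaf.stalk z => w ^ p ^ e) ''
          (I : Set (Z.presheaf.stalk z)))) → y ∈ I)
    ?_ X U ?_ S hcov hloc
  · -- `P` glues along two-piece open covers: stalk maps of open immersions are isomorphisms
    intro Z A B i j _ _ hcover hA hB z
    have hz : z ∈ i.opensRange ⊔ j.opensRange := by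
      rw [hcover]
      exact Opens.mem_top z
    rcases Opens.mem_sup.mp hz with h | h
    · obtain ⟨a, rfl⟩ := Scheme.Hom.mem_opensRange.mp h
      exact domain_allIdeals_clause_of_iso p (asIso (i.stalkMap a)) (hA a)
    · obtain ⟨b, rfl⟩ := Scheme.Hom.mem_opensRange.mp h
      exact domain_allIdeals_clause_of_iso p (asIso (j.stalkMap b)) (hB b)
  · -- `P ↑U`: the stalks of the open subscheme `↑U` are those of `X` at the points of `U`
    intro u
    exact domain_allIdeals_clause_of_iso p (asIso (U.ι.stalkMap u)).symm (hU u.1 u.2)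

end Summit.ResolutionOfSingularities.ResolutionOfSingularities.Theorems.FRationalResolution

end
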